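/-
Copyright (c) 2026 the pub-hodgecm-mathlib formalisation cell (harness21).  Prover seat hodgecm-mathlib-F0P2-p01 (g11), programme P2,
row B″ «OCC♭∀ GLUE HEAD» over the desk's OCC♭-GEN census (`F0/P2/CENSUS-OCCGEN-T5currency.F0P2-plan-g12.md` §2 «★ heads»), 2026-09-01.
KERNEL module: THEOREMS ONLY (no definition, no named fact, no `sorry`, no instance, no notation).
-/
import Summits.HodgeConjecture.HodgeConjecture.Theorems.F0P2sNodeBPrimeHolds        -- ★ p843730 node B′ (χ-resolved finite component)
import Summits.HodgeConjecture.HodgeConjecture.Theorems.F0P2dSocketD                 -- ★ (D)h ∕ (D̄) `holCotFormSpectralProjection_holds` ∕ `antihol…_holds`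
import Summits.HodgeConjecture.HodgeConjecture.Theorems.F0P2aCohFormsContinuous      -- ★ `exists_toLp_ne_zero_of_mem_cohForms_cm`
import Summits.HodgeConjecture.HodgeConjecture.Theorems.F0P3HolProjectionReduction   -- ★ `compactSpace_automorphicQuotient_cm`, `four_le_finrank_of_two_le`
import Literature.NumberTheory.Automorphic.AdelicUnitaryGroupSpectrum                -- ★ `isDiscretelyDecomposable_rightRegular_adelicGroupData`
import Literature.NumberTheory.Automorphic.DiscreteSummandProjection                 -- ★ `exists_discreteAutomorphicRep_starProjection_ne_zero`
import HarnessLib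

/-!
# FLOOR-0 P2 · B″ «OCC♭∀ GLUE HEAD»: a non-zero (hol ∨ antihol)-cotangent PAIR OF THETA LIFTS of `(a, χ)` gives a discrete `P` with
# `(P.IsHolCotangentAt ∨ P.IsAntiholCotangentAt) ∧ P.HasFinComponent (rhoAtLine … ιV a χ)` — OCC♭∀'s conclusion, token for token

Cell hodgecm-mathlib (D-0151), FLOOR 0; crux item H413 = stmt-HodgeConjecture-24833 (route `HCCMUnconditional`, no route verbs); programme P2,
sub-line E3-RELSIGN (`Cruxes/H413/Lines/F0_P2E3RelSign.lean`, ED. 2 «ONE MEASURE»), stub OCC♭∀ `stub_occFlatAll` (`StubOccFlatAdmissibleAll`, books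
#155′) and its planned in-house pay-down line «OCC♭-GEN» (desk F0P2-plan (g12), PLAN-P2 v13 §2 + `F0/P2/CENSUS-OCCGEN-T5currency.F0P2-plan-g12.md`).
THEOREMS ONLY; `--supports stmt-HodgeConjecture-24833`.  HONEST LABEL: HC_CM is proved only modulo the printed citations until rung 0 closes;
this file closes NO print letter — it is the sorry-free GLUE between a theta CONSTRUCTION (the content of the desk's stubs (N) «Θ ≠ 0» and (T)
«Θ is (hol ∨ antihol)-cotangent», [Liu2021, Prop. 4.13 «Conversely»; GelbartRogawski1991 Prop. 3.1.1; KonnoKonno2007 Thm 5.4]) and OCC♭∀'s conclusion.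

## What is proved
In the frame of OCC♭∀ VERBATIM — `L` CM, `ι`, `H` with a `(2,1)`-frame `T` at `ι` (`hT`), definite at the other complex places (`hdef`), `[L⁺:ℚ] ≥ 2`
(`h2`), a diagonal frame `(e₁, dV, hdV, hdV0, g, hg)`, a finite transport `ιV` pinned by `↑(ιV k) = g_f⁻¹ k g_f` (`hιV`), ANY automorphic measure
`μA`, a conjugate-symplectic `μ` (`hμ`), a line `a` and a character `χ ∈ Chi` — plus theta data (Weil majorants `hρ`, a finite invariant measure `μW`
on `[U(⟨a⟩)]`, the instance `[CompactSpace [U(diag dV)]]` under which theta lifts are defined — discharged in this frame by ★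
`Liu2021.compactSpace_quotient_diagonalFrame ι hdef h2 hg` — archimedean Schwartz factors `φ j`, finite Schwartz–Bruhat factors `Φf j`, `j : Fin 2`):
* **`exists_cotangent_hasFinComponent_of_thetaCotForm`** — if the pair of descended theta lifts
  `Θ := fun x j => Θ̃_{R_e E(φ j ⊗ Φf j)}(charCM χ̃_χ) (ιA x)` (`ιA = cmAdelicFrameTransport L 3 H dV g hg`) lies in
  `holCotForms … (cmArchSection L ι H T hT) (cmCompactFactor L ι H T hT)` or in its `conjFun`-image, and `Θ ≠ 0`, then
  `∃ P : DiscreteAutomorphicRep … μA, (P.IsHolCotangentAt … ∨ P.IsAntiholCotangentAt …) ∧ P.HasFinComponent (rhoAtLine … ιV a χ)`;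
* **`exists_cotangent_hasFinComponent_of_thetaCotForm'`** — the same with the form a binder `Θ` and `hΘ : ∀ x j, Θ x j = …`;
* the two halves **`exists_isHolCotangentAt_hasFinComponent_of_thetaHolCotForm`** ∕ **`exists_isAntiholCotangentAt_hasFinComponent_of_thetaAntiholCotForm`**
  (hol input ⟹ hol `P`; antihol input ⟹ antihol `P`).
PROOF (all inputs ★): `[U(H)]` is compact (★ `compactSpace_automorphicQuotient_cm`; so is `[U(diag dV)]`, ★ `compactSpace_quotient_diagonalFrame`); the
coordinates of `Θ` are continuous on the compact quotient hence `L²(μA)` (★ `memLp_toQuotFun_lineThetaLift`); `Θ ≠ 0` continuous and `μA` positive on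
opens ⟹ some coordinate CLASS `[Θ_j] ≠ 0` (★ `exists_toLp_ne_zero_of_mem_cohForms_cm`); `L²([U(H)], μA)` decomposes discretely (`H` anisotropic,
[GelfandGraevPiatetskiShapiro1969], ★ `isDiscretelyDecomposable_rightRegular_adelicGroupData`) ⟹ a discrete `P` with `pr_P [Θ_j] ≠ 0` (★
`exists_discreteAutomorphicRep_starProjection_ne_zero`); (D)h ∕ (D̄) ★ `holCotFormSpectralProjection_holds` ∕ `antiholCotFormSpectralProjection_holds`:
`(pr_P [Θ₀], pr_P [Θ₁])` are the classes of a cotangent form `Ψ` of the same type, contained in `P` and non-zero ⟹ `P.IsHolCotangentAt` (resp.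
antihol); node B′ ★ `hasFinComponent_rhoAtLine_three_of_starProjection_ne_zero_of_coe` at `(φ j, Φf j)` ⟹ `P.HasFinComponent (rhoAtLine … ιV a χ)`.
⇒ OCC♭∀ ⟸ «for every `μ`-admissible `a` and every `χ`: SOME theta pair of `(a, χ)` is (hol ∨ antihol)-cotangent and non-zero» (the desk's (N)+(T)).

## References
* [Liu2021] Y. Liu, *Fourier–Jacobi cycles and arithmetic relative trace formula*, Camb. J. Math. 9 (2021) = arXiv:2102.11518, Prop. 4.13
  (proof, Case 1 l. 2131–2137 and «Conversely» l. 2145–2149); Def. 4.11; App. D §D.1, Lemma D.1–D.2.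
* [GelbartRogawski1991] S. Gelbart, J. Rogawski, Invent. Math. 105 (1991), §3 Prop. 3.1.1, §3.2 p. 457.
* [BorelJacquet1979] A. Borel, H. Jacquet, PSPM 33.1 (1979), §4.6 (`L²_d`, projections commute with `G(𝔸)`).
* [GelfandGraevPiatetskiShapiro1969] I. M. Gelfand, M. I. Graev, I. I. Piatetski-Shapiro, Ch. 1 §2.3 (compact quotient: discrete decomposition).
* [DeitmarEchterhoff2014] A. Deitmar, S. Echterhoff, *Principles of Harmonic Analysis*, 2nd ed., Thm. 9.2.2.
* [BorelWallach2000] A. Borel, N. Wallach, 2nd ed. (2000), VII 2.10, 3.2.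
-/

set_option autoImplicit false

-- the mandated namespace has the single-problem summit's repeated segment (`HodgeConjecture.HodgeConjecture`)
set_option linter.dupNamespace false

noncomputable section

open NumberField MeasureTheory IsDedekindDomain
open scoped Matrix Kronecker ComplexOrder ENNReal SchwartzMap TensorProduct Classical

namespace Summit.HodgeConjecture.HodgeConjecture.Cruxes.H413.F0P2sOccFlatOfThetaForm

open Literature.NumberTheory.Automorphic Literature.NumberTheory.Automorphic.UnitaryGroup
open Literature.NumberTheory.Automorphic.UnitaryGroup.CotangentForms
open Literature.NumberTheory.Automorphic.IdeleClassGroup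
open Literature.NumberTheory.Automorphic.Liu2021
open Literature.NumberTheory.Automorphic.Liu2021.Def411WeilCarriers
open Literature.NumberTheory.Automorphic.Liu2021.Def411WeilCarriersDoubling
open Literature.NumberTheory.GelbartRogawski1991 Literature.NumberTheory.GelbartRogawski1991.UnitaryDualPair
open Literature.NumberTheory.GelbartRogawski1991.UnitaryDualPair.WeilCoinv
open Literature.NumberTheory.Weil1964
open Literature.RepresentationTheory Literature.RepresentationTheory.Liu2021
open Literature.RepresentationTheory.CompactGroups
open Summit.HodgeConjecture.HodgeConjecture.Cruxes.H413

variable (L : Type) [Field L] [NumberField L] [IsCMField L] (ι : L →+* ℂ) (H : Matrix (Fin 3) (Fin 3) L) (T : GL (Fin 3) ℂ)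
  (hT : (T : Matrix (Fin 3) (Fin 3) ℂ)ᴴ * H.map ι * (T : Matrix (Fin 3) (Fin 3) ℂ) = Literature.Geometry.ComplexHyperbolic.BallModel.J)
  (hdef : ∀ τ' : L →+* ℂ, InfinitePlace.mk τ' ≠ InfinitePlace.mk ι → (H.map τ').PosDef) (h2 : 2 ≤ Module.finrank ℚ ↥(maximalRealSubfield L))
  {n' : ℕ} (e₁ : Fin 3 × Fin 1 ≃ Fin n') (dV : Fin 3 → L) (hdV : ∀ i, IsCMField.complexConj L (dV i) = dV i)
  (hdV0 : ∀ i, dV i ≠ 0) (g : GL (Fin 3) L)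
  (hg : ((g : Matrix (Fin 3) (Fin 3) L).map (cmConjRingHom L))ᵀ * H * (g : Matrix (Fin 3) (Fin 3) L) = Matrix.diagonal dV)
  (ιV : finAdelic (↥(maximalRealSubfield L)) L (IsCMField.complexConj L) 3 H →*
    finAdelic (↥(maximalRealSubfield L)) L (IsCMField.complexConj L) 3 (Matrix.diagonal dV))
  (hιV : ∀ k, ((ιV k : finAdelic (↥(maximalRealSubfield L)) L (IsCMField.complexConj L) 3 (Matrix.diagonal dV)) :
        GL (Fin 3) (FiniteAdeleRing (𝓞 L) L)) =
      (toFinAdeleGL L 3 g)⁻¹ * (k : GL (Fin 3) (FiniteAdeleRing (𝓞 L) L)) * toFinAdeleGL L 3 g)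
  (μA : Measure (adelicGroupData (↥(maximalRealSubfield L)) L (IsCMField.complexConj L) 3 H).automorphicQuotient)
  [(adelicGroupData (↥(maximalRealSubfield L)) L (IsCMField.complexConj L) 3 H).IsAutomorphicMeasure μA]
  (μ : Literature.NumberTheory.Automorphic.IdeleClassGroup L →ₜ* Circle) (hμ : IsConjugateSymplectic L μ) (a : (↥(maximalRealSubfield L))ˣ)
  (χ : Chi (↥(maximalRealSubfield L)) L (IsCMField.complexConj L))
  (hρ : HasThetaMajorants fun
      (p : ↥(UnitaryGroup.adelic (↥(maximalRealSubfield L)) L (IsCMField.complexConj L) 3 (Matrix.diagonal dV)) × ↥(UnitaryGroup.adelic (↥(maximalRealSubfield L)) L (IsCMField.complexConj L) 1 (JW (↥(maximalRealSubfield L)) L a))) (Φ : piSchwartzBruhat (↥(maximalRealSubfield L)) (Fin n')) =>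
        pairRep (↥(maximalRealSubfield L)) L (IsCMField.complexConj L) 3 1 e₁ (Matrix.diagonal dV) (JW (↥(maximalRealSubfield L)) L a)
          (chiSplittingLine L e₁ dV hdV hdV0 (toHeckeCharacter L μ) (isUnitary_toHeckeCharacter L μ)
            ((isOscillatorChar_toHeckeCharacter_iff μ).mpr hμ) (TW (↥(maximalRealSubfield L)) a)
            (isUnit_det_TW (↥(maximalRealSubfield L)) a) (JW (↥(maximalRealSubfield L)) L a) (JW_eq (↥(maximalRealSubfield L)) L a))
          p Φ)
  [CompactSpace (↥(UnitaryGroup.adelic (↥(maximalRealSubfield L)) L (IsCMField.complexConj L) 3 (Matrix.diagonal dV)) ⧸ (UnitaryGroup.toAdelic (↥(maximalRealSubfield L)) L (IsCMField.complexConj L) 3 (Matrix.diagonal dV)).range)]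
  [MeasurableSpace (↥(UnitaryGroup.adelic (↥(maximalRealSubfield L)) L (IsCMField.complexConj L) 1 (JW (↥(maximalRealSubfield L)) L a)) ⧸ (UnitaryGroup.toAdelic (↥(maximalRealSubfield L)) L (IsCMField.complexConj L) 1 (JW (↥(maximalRealSubfield L)) L a)).range)] [BorelSpace (↥(UnitaryGroup.adelic (↥(maximalRealSubfield L)) L (IsCMField.complexConj L) 1 (JW (↥(maximalRealSubfield L)) L a)) ⧸ (UnitaryGroup.toAdelic (↥(maximalRealSubfield L)) L (IsCMField.complexConj L) 1 (JW (↥(maximalRealSubfield L)) L a)).range)] (μW : Measure (↥(UnitaryGroup.adelic (↥(maximalRealSubfield L)) L (IsCMField.complexConj L) 1 (JW (↥(maximalRealSubfield L)) L a)) ⧸ (UnitaryGroup.toAdelic (↥(maximalRealSubfield L)) L (IsCMField.complexConj L) 1 (JW (↥(maximalRealSubfield L)) L a)).range)) [IsFiniteMeasure μW] [SMulInvariantMeasure ↥(UnitaryGroup.adelic (↥(maximalRealSubfield L)) L (IsCMField.complexConj L) 1 (JW (↥(maximalRealSubfield L)) L a)) (↥(UnitaryGroup.adelic (↥(maximalRealSubfield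 L)) L (IsCMField.complexConj L) 1 (JW (↥(maximalRealSubfield L)) L a)) ⧸ (UnitaryGroup.toAdelic (↥(maximalRealSubfield L)) L (IsCMField.complexConj L) 1 (JW (↥(maximalRealSubfield L)) L a)).range) μW]
  (φ : Fin 2 → 𝓢(((Fin 3 × Fin 1) → NumberField.mixedEmbedding.mixedSpace ↥(maximalRealSubfield L)), ℂ))
  (Φf : Fin 2 → FinSB (↥(maximalRealSubfield L)) (Fin 3 × Fin 1))

/-! ## §1 The two halves: hol theta pair ⟹ hol `P`; antihol theta pair ⟹ antihol `P` -/

include hT hdef h2 hg hιV in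
set_option synthInstance.maxHeartbeats 400000 in
set_option maxHeartbeats 4000000 in
/-- **B″ (holomorphic half).**  If the pair of descended theta lifts `Θ = (Θ̃_{R_e E(φ 0 ⊗ Φf 0)}(charCM χ̃_χ) ∘ ιA, Θ̃_{R_e E(φ 1 ⊗ Φf 1)}(charCM χ̃_χ) ∘ ιA)`
of the line `⟨a⟩` at the `μ`-splitting is a NON-ZERO HOLOMORPHIC COTANGENT FORM of the frame `(cmArchSection, cmCompactFactor)` at `ι`, then some discrete
`P ⊂ L²([U(H)], μA)` is `H¹`-holomorphic-cotangent at `ι` AND has finite component `ω(μ, ε_a, χ)_f = rhoAtLine … ιV a χ`: pick `P` with `pr_P [Θ_j] ≠ 0`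
(compact quotient ⟹ discrete decomposition, [GelfandGraevPiatetskiShapiro1969]; [BorelJacquet1979, §4.6]), read its type off (D)h ★
`holCotFormSpectralProjection_holds` and its finite component off node B′ ★ `hasFinComponent_rhoAtLine_three_of_starProjection_ne_zero_of_coe`.
[cite: Liu2021, Prop. 4.13 proof (Case 1 l. 2131–2137; «Conversely» l. 2145–2149); App. D Lemma D.1] [cite: GelbartRogawski1991, Prop 3.1.1; §3.2 p. 457]
[cite: BorelJacquet1979, §4.6] [cite: DeitmarEchterhoff2014, Thm. 9.2.2] -/
theorem exists_isHolCotangentAt_hasFinComponent_of_thetaHolCotForm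
    (hhol : haveI := normal_range_toAdelic_JW L a
      (fun (x : (adelicGroupData (↥(maximalRealSubfield L)) L (IsCMField.complexConj L) 3 H).Adelic) (j : Fin 2) =>
          (lineThetaKernelDatum L 3 e₁ dV hdV hdV0 μ hμ a hρ).thetaLiftFun μW
            (piSBReindex (↥(maximalRealSubfield L)) e₁ (piSchwartzBruhatEquiv (↥(maximalRealSubfield L)) (Fin 3 × Fin 1) (φ j ⊗ₜ[ℂ] Φf j)))
            (charCM (chiQuot (↥(maximalRealSubfield L)) L (IsCMField.complexConj L) (Algebra.IsQuadraticExtension.finrank_eq_two _ L)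
              (IsCMField.complexConj_ne_one (K := L)) a χ))
            ((cmAdelicFrameTransport L 3 H dV g hg) x)) ∈
        holCotForms (↥(maximalRealSubfield L)) L (IsCMField.complexConj L) 3 H (cmArchSection L ι H T hT) (cmCompactFactor L ι H T hT))
    (hne : haveI := normal_range_toAdelic_JW L a
      (fun (x : (adelicGroupData (↥(maximalRealSubfield L)) L (IsCMField.complexConj L) 3 H).Adelic) (j : Fin 2) =>
          (lineThetaKernelDatum L 3 e₁ dV hdV hdV0 μ hμ a hρ).thetaLiftFun μW
            (piSBReindex (↥(maximalRealSubfield L)) e₁ (piSchwartzBruhatEquiv (↥(maximalRealSubfield L)) (Fin 3 × Fin 1) (φ j ⊗ₜ[ℂ] Φf j)))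
            (charCM (chiQuot (↥(maximalRealSubfield L)) L (IsCMField.complexConj L) (Algebra.IsQuadraticExtension.finrank_eq_two _ L)
              (IsCMField.complexConj_ne_one (K := L)) a χ))
            ((cmAdelicFrameTransport L 3 H dV g hg) x)) ≠ 0) :
    ∃ P : DiscreteAutomorphicRep (adelicGroupData (↥(maximalRealSubfield L)) L (IsCMField.complexConj L) 3 H) μA,
      P.IsHolCotangentAt (cmArchSection L ι H T hT) (cmCompactFactor L ι H T hT) ∧
        P.HasFinComponent
          (rhoAtLine (↥(maximalRealSubfield L)) L (IsCMField.complexConj L) 3 e₁ (Matrix.diagonal dV)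
            (complexConj_imagUnit L) (imagUnit_ne_zero L) (imagUnit_mul_self L) (realDiagonal_isSymm L dV hdV)
            (isUnit_det_realDiagonal L dV hdV hdV0) (realDiagonal_map L dV hdV).symm
            (fun b => isCompatible_chiSplittingLine L e₁ dV hdV hdV0 (toHeckeCharacter L μ)
              (isUnitary_toHeckeCharacter L μ) ((isOscillatorChar_toHeckeCharacter_iff μ).mpr hμ)
              (TW (↥(maximalRealSubfield L)) b) (isSymm_TW (↥(maximalRealSubfield L)) b)
              (isUnit_det_TW (↥(maximalRealSubfield L)) b) (JW (↥(maximalRealSubfield L)) L b)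
              (JW_eq (↥(maximalRealSubfield L)) L b)) ιV a χ) := by
  haveI := normal_range_toAdelic_JW L a
  -- the compact quotient `[U(H)]` (`[U(diag dV)]` is compact too, ★ `compactSpace_quotient_diagonalFrame ι hdef h2 hg` — an instance binder here)
  haveI : CompactSpace (adelicGroupData (↥(maximalRealSubfield L)) L (IsCMField.complexConj L) 3 H).automorphicQuotient :=
    F0P3HolProjectionReduction.compactSpace_automorphicQuotient_cm hdef h2
  -- the coordinates of `Θ` are `L²` on the compact quotient
  have hm : ∀ j : Fin 2, MemLp (toQuotFun (adelicGroupData (↥(maximalRealSubfield L)) L (IsCMField.complexConj L) 3 H) fun x =>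
      (lineThetaKernelDatum L 3 e₁ dV hdV hdV0 μ hμ a hρ).thetaLiftFun μW
        (piSBReindex (↥(maximalRealSubfield L)) e₁ (piSchwartzBruhatEquiv (↥(maximalRealSubfield L)) (Fin 3 × Fin 1) (φ j ⊗ₜ[ℂ] Φf j)))
        (charCM (chiQuot (↥(maximalRealSubfield L)) L (IsCMField.complexConj L) (Algebra.IsQuadraticExtension.finrank_eq_two _ L)
          (IsCMField.complexConj_ne_one (K := L)) a χ))
        ((cmAdelicFrameTransport L 3 H dV g hg) x)) 2 μA :=
    fun j => memLp_toQuotFun_lineThetaLift L 3 H e₁ dV hdV hdV0 g hg μ hμ a hρ μW _ _ μA 2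
  -- a non-zero coordinate class (`μA` positive on opens, the form is continuous)
  obtain ⟨j, hj⟩ := F0P2aCohFormsContinuous.exists_toLp_ne_zero_of_mem_cohForms_cm (holCotForms_le_cohForms hhol) hne hm
  -- `L²([U(H)], μA)` decomposes discretely (`H` anisotropic): a discrete `P` on which that class projects non-trivially
  obtain ⟨τ, hτ⟩ := UnitaryGroup.exists_infinitePlace_ne L (F0P3HolProjectionReduction.four_le_finrank_of_two_le h2) ι
  have hd := UnitaryGroup.isDiscretelyDecomposable_rightRegular_adelicGroupData L 3 H
    (UnitaryGroup.anisotropic_of_posDef_map L H τ (hdef τ hτ)) μA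
  obtain ⟨P, hP⟩ := exists_discreteAutomorphicRep_starProjection_ne_zero hd hj
  refine ⟨P, ?_, ?_⟩
  · -- (D)h: the projected pair is the pair of classes of a holomorphic cotangent form `Ψ`, contained in `P`, non-zero at `j`
    obtain ⟨Ψ, hΨ, hΨ', heq⟩ := F0P2dSocketD.holCotFormSpectralProjection_holds L ι H T hT hdef h2 μA P _ hhol hm
    refine ⟨Ψ, hΨ, ?_, fun j' => ⟨hΨ' j', ?_⟩⟩
    · rintro rfl
      apply hP
      rw [heq j]
      exact MemLp.toLp_zero (hΨ' j)
    · rw [← heq j']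
      exact Submodule.starProjection_apply_mem _ _
  · -- node B′ at `(φ j, Φf j)`
    exact F0P2sNodeBPrime.hasFinComponent_rhoAtLine_three_of_starProjection_ne_zero_of_coe L H e₁ dV hdV hdV0 g hg μ hμ a hρ μW
      (φ j) P χ (Φf j) ιV hιV hP

include hT hdef h2 hg hιV in
set_option synthInstance.maxHeartbeats 400000 in
set_option maxHeartbeats 4000000 in
/-- **B″ (antiholomorphic half).**  The same with the theta pair an ANTIHOLOMORPHIC cotangent form (a member of the `conjFun`-image of `holCotForms …`):
some discrete `P` is `H¹`-antiholomorphic-cotangent at `ι` ((D̄) ★ `antiholCotFormSpectralProjection_holds`) with finite component `rhoAtLine … ιV a χ` (node B′).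
[cite: Liu2021, Prop. 4.13 proof (Case 1 l. 2131–2137; «Conversely» l. 2145–2149); App. D Lemma D.1] [cite: GelbartRogawski1991, Prop 3.1.1; §3.2 p. 457]
[cite: BorelJacquet1979, §4.6] [cite: BorelWallach2000, VII 2.10] [cite: DeitmarEchterhoff2014, Thm. 9.2.2] -/
theorem exists_isAntiholCotangentAt_hasFinComponent_of_thetaAntiholCotForm
    (hah : haveI := normal_range_toAdelic_JW L a
      (fun (x : (adelicGroupData (↥(maximalRealSubfield L)) L (IsCMField.complexConj L) 3 H).Adelic) (j : Fin 2) =>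
          (lineThetaKernelDatum L 3 e₁ dV hdV hdV0 μ hμ a hρ).thetaLiftFun μW
            (piSBReindex (↥(maximalRealSubfield L)) e₁ (piSchwartzBruhatEquiv (↥(maximalRealSubfield L)) (Fin 3 × Fin 1) (φ j ⊗ₜ[ℂ] Φf j)))
            (charCM (chiQuot (↥(maximalRealSubfield L)) L (IsCMField.complexConj L) (Algebra.IsQuadraticExtension.finrank_eq_two _ L)
              (IsCMField.complexConj_ne_one (K := L)) a χ))
            ((cmAdelicFrameTransport L 3 H dV g hg) x)) ∈
        (holCotForms (↥(maximalRealSubfield L)) L (IsCMField.complexConj L) 3 H (cmArchSection L ι H T hT) (cmCompactFactor L ι H T hT)).map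
          (conjFun (↥(maximalRealSubfield L)) L (IsCMField.complexConj L) 3 H))
    (hne : haveI := normal_range_toAdelic_JW L a
      (fun (x : (adelicGroupData (↥(maximalRealSubfield L)) L (IsCMField.complexConj L) 3 H).Adelic) (j : Fin 2) =>
          (lineThetaKernelDatum L 3 e₁ dV hdV hdV0 μ hμ a hρ).thetaLiftFun μW
            (piSBReindex (↥(maximalRealSubfield L)) e₁ (piSchwartzBruhatEquiv (↥(maximalRealSubfield L)) (Fin 3 × Fin 1) (φ j ⊗ₜ[ℂ] Φf j)))
            (charCM (chiQuot (↥(maximalRealSubfield L)) L (IsCMField.complexConj L) (Algebra.IsQuadraticExtension.finrank_eq_two _ L)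
              (IsCMField.complexConj_ne_one (K := L)) a χ))
            ((cmAdelicFrameTransport L 3 H dV g hg) x)) ≠ 0) :
    ∃ P : DiscreteAutomorphicRep (adelicGroupData (↥(maximalRealSubfield L)) L (IsCMField.complexConj L) 3 H) μA,
      P.IsAntiholCotangentAt (cmArchSection L ι H T hT) (cmCompactFactor L ι H T hT) ∧
        P.HasFinComponent
          (rhoAtLine (↥(maximalRealSubfield L)) L (IsCMField.complexConj L) 3 e₁ (Matrix.diagonal dV)
            (complexConj_imagUnit L) (imagUnit_ne_zero L) (imagUnit_mul_self L) (realDiagonal_isSymm L dV hdV)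
            (isUnit_det_realDiagonal L dV hdV hdV0) (realDiagonal_map L dV hdV).symm
            (fun b => isCompatible_chiSplittingLine L e₁ dV hdV hdV0 (toHeckeCharacter L μ)
              (isUnitary_toHeckeCharacter L μ) ((isOscillatorChar_toHeckeCharacter_iff μ).mpr hμ)
              (TW (↥(maximalRealSubfield L)) b) (isSymm_TW (↥(maximalRealSubfield L)) b)
              (isUnit_det_TW (↥(maximalRealSubfield L)) b) (JW (↥(maximalRealSubfield L)) L b)
              (JW_eq (↥(maximalRealSubfield L)) L b)) ιV a χ) := by
  haveI := normal_range_toAdelic_JW L a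
  haveI : CompactSpace (adelicGroupData (↥(maximalRealSubfield L)) L (IsCMField.complexConj L) 3 H).automorphicQuotient :=
    F0P3HolProjectionReduction.compactSpace_automorphicQuotient_cm hdef h2
  have hm : ∀ j : Fin 2, MemLp (toQuotFun (adelicGroupData (↥(maximalRealSubfield L)) L (IsCMField.complexConj L) 3 H) fun x =>
      (lineThetaKernelDatum L 3 e₁ dV hdV hdV0 μ hμ a hρ).thetaLiftFun μW
        (piSBReindex (↥(maximalRealSubfield L)) e₁ (piSchwartzBruhatEquiv (↥(maximalRealSubfield L)) (Fin 3 × Fin 1) (φ j ⊗ₜ[ℂ] Φf j)))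
        (charCM (chiQuot (↥(maximalRealSubfield L)) L (IsCMField.complexConj L) (Algebra.IsQuadraticExtension.finrank_eq_two _ L)
          (IsCMField.complexConj_ne_one (K := L)) a χ))
        ((cmAdelicFrameTransport L 3 H dV g hg) x)) 2 μA :=
    fun j => memLp_toQuotFun_lineThetaLift L 3 H e₁ dV hdV hdV0 g hg μ hμ a hρ μW _ _ μA 2
  obtain ⟨j, hj⟩ := F0P2aCohFormsContinuous.exists_toLp_ne_zero_of_mem_cohForms_cm (Submodule.mem_sup_right hah) hne hm
  obtain ⟨τ, hτ⟩ := UnitaryGroup.exists_infinitePlace_ne L (F0P3HolProjectionReduction.four_le_finrank_of_two_le h2) ι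
  have hd := UnitaryGroup.isDiscretelyDecomposable_rightRegular_adelicGroupData L 3 H
    (UnitaryGroup.anisotropic_of_posDef_map L H τ (hdef τ hτ)) μA
  obtain ⟨P, hP⟩ := exists_discreteAutomorphicRep_starProjection_ne_zero hd hj
  refine ⟨P, ?_, ?_⟩
  · obtain ⟨Ψ, hΨ, hΨ', heq⟩ := F0P2dSocketD.antiholCotFormSpectralProjection_holds L ι H T hT hdef h2 μA P _ hah hm
    refine ⟨Ψ, hΨ, ?_, fun j' => ⟨hΨ' j', ?_⟩⟩
    · rintro rfl
      apply hP
      rw [heq j]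
      exact MemLp.toLp_zero (hΨ' j)
    · rw [← heq j']
      exact Submodule.starProjection_apply_mem _ _
  · exact F0P2sNodeBPrime.hasFinComponent_rhoAtLine_three_of_starProjection_ne_zero_of_coe L H e₁ dV hdV hdV0 g hg μ hμ a hρ μW
      (φ j) P χ (Φf j) ιV hιV hP

/-! ## §2 The OCC♭∀ glue head -/

include hT hdef h2 hg hιV in
set_option synthInstance.maxHeartbeats 400000 in
set_option maxHeartbeats 4000000 in
/-- **B″ — THE OCC♭∀ GLUE HEAD.**  In OCC♭∀'s frame, token for token: if for theta data `(hρ, μW, φ, Φf)` the pair of descended theta lifts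
`Θ := fun x j => Θ̃_{R_e E(φ j ⊗ Φf j)}(charCM χ̃_χ) (ιA x)` of `(a, χ)` is a (holomorphic ∨ antiholomorphic) cotangent form of the frame at `ι` and
`Θ ≠ 0`, then `∃ P : DiscreteAutomorphicRep … μA, (P.IsHolCotangentAt … ∨ P.IsAntiholCotangentAt …) ∧ P.HasFinComponent (rhoAtLine … ιV a χ)` —
the conclusion of `StubOccFlatAdmissibleAll` (`Cruxes/H413/Lines/F0_P2E3RelSign.lean` ED. 2 :240).  So OCC♭∀ ⟸ «for every `μ`-admissible `a` and every
`χ ∈ Chi` SOME theta pair of `(a, χ)` is cotangent and non-zero» ([Liu2021, Prop. 4.13 «Conversely»]: the global theta lift of `χ` from the admissible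
line is a non-zero cotangent cusp form; [GelbartRogawski1991, Prop. 3.1.1]; archimedean type [KonnoKonno2007]).
[cite: Liu2021, Prop. 4.13 proof (Case 1 l. 2131–2137; «Conversely» l. 2145–2149); Def. 4.11; App. D Lemma D.1] [cite: GelbartRogawski1991, Prop 3.1.1; §3.2 p. 457]
[cite: BorelJacquet1979, §4.6] [cite: DeitmarEchterhoff2014, Thm. 9.2.2] -/
theorem exists_cotangent_hasFinComponent_of_thetaCotForm
    (htype : haveI := normal_range_toAdelic_JW L a
      (fun (x : (adelicGroupData (↥(maximalRealSubfield L)) L (IsCMField.complexConj L) 3 H).Adelic) (j : Fin 2) =>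
          (lineThetaKernelDatum L 3 e₁ dV hdV hdV0 μ hμ a hρ).thetaLiftFun μW
            (piSBReindex (↥(maximalRealSubfield L)) e₁ (piSchwartzBruhatEquiv (↥(maximalRealSubfield L)) (Fin 3 × Fin 1) (φ j ⊗ₜ[ℂ] Φf j)))
            (charCM (chiQuot (↥(maximalRealSubfield L)) L (IsCMField.complexConj L) (Algebra.IsQuadraticExtension.finrank_eq_two _ L)
              (IsCMField.complexConj_ne_one (K := L)) a χ))
            ((cmAdelicFrameTransport L 3 H dV g hg) x)) ∈
        holCotForms (↥(maximalRealSubfield L)) L (IsCMField.complexConj L) 3 H (cmArchSection L ι H T hT) (cmCompactFactor L ι H T hT) ∨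
      (fun (x : (adelicGroupData (↥(maximalRealSubfield L)) L (IsCMField.complexConj L) 3 H).Adelic) (j : Fin 2) =>
          (lineThetaKernelDatum L 3 e₁ dV hdV hdV0 μ hμ a hρ).thetaLiftFun μW
            (piSBReindex (↥(maximalRealSubfield L)) e₁ (piSchwartzBruhatEquiv (↥(maximalRealSubfield L)) (Fin 3 × Fin 1) (φ j ⊗ₜ[ℂ] Φf j)))
            (charCM (chiQuot (↥(maximalRealSubfield L)) L (IsCMField.complexConj L) (Algebra.IsQuadraticExtension.finrank_eq_two _ L)
              (IsCMField.complexConj_ne_one (K := L)) a χ))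
            ((cmAdelicFrameTransport L 3 H dV g hg) x)) ∈
        (holCotForms (↥(maximalRealSubfield L)) L (IsCMField.complexConj L) 3 H (cmArchSection L ι H T hT) (cmCompactFactor L ι H T hT)).map
          (conjFun (↥(maximalRealSubfield L)) L (IsCMField.complexConj L) 3 H))
    (hne : haveI := normal_range_toAdelic_JW L a
      (fun (x : (adelicGroupData (↥(maximalRealSubfield L)) L (IsCMField.complexConj L) 3 H).Adelic) (j : Fin 2) =>
          (lineThetaKernelDatum L 3 e₁ dV hdV hdV0 μ hμ a hρ).thetaLiftFun μW
            (piSBReindex (↥(maximalRealSubfield L)) e₁ (piSchwartzBruhatEquiv (↥(maximalRealSubfield L)) (Fin 3 × Fin 1) (φ j ⊗ₜ[ℂ] Φf j)))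
            (charCM (chiQuot (↥(maximalRealSubfield L)) L (IsCMField.complexConj L) (Algebra.IsQuadraticExtension.finrank_eq_two _ L)
              (IsCMField.complexConj_ne_one (K := L)) a χ))
            ((cmAdelicFrameTransport L 3 H dV g hg) x)) ≠ 0) :
    ∃ P : DiscreteAutomorphicRep (adelicGroupData (↥(maximalRealSubfield L)) L (IsCMField.complexConj L) 3 H) μA,
      (P.IsHolCotangentAt (cmArchSection L ι H T hT) (cmCompactFactor L ι H T hT) ∨
          P.IsAntiholCotangentAt (cmArchSection L ι H T hT) (cmCompactFactor L ι H T hT)) ∧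
        P.HasFinComponent
          (rhoAtLine (↥(maximalRealSubfield L)) L (IsCMField.complexConj L) 3 e₁ (Matrix.diagonal dV)
            (complexConj_imagUnit L) (imagUnit_ne_zero L) (imagUnit_mul_self L) (realDiagonal_isSymm L dV hdV)
            (isUnit_det_realDiagonal L dV hdV hdV0) (realDiagonal_map L dV hdV).symm
            (fun b => isCompatible_chiSplittingLine L e₁ dV hdV hdV0 (toHeckeCharacter L μ)
              (isUnitary_toHeckeCharacter L μ) ((isOscillatorChar_toHeckeCharacter_iff μ).mpr hμ)
              (TW (↥(maximalRealSubfield L)) b) (isSymm_TW (↥(maximalRealSubfield L)) b)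
              (isUnit_det_TW (↥(maximalRealSubfield L)) b) (JW (↥(maximalRealSubfield L)) L b)
              (JW_eq (↥(maximalRealSubfield L)) L b)) ιV a χ) := by
  rcases htype with hhol | hah
  · obtain ⟨P, hP, hfc⟩ := exists_isHolCotangentAt_hasFinComponent_of_thetaHolCotForm L ι H T hT hdef h2 e₁ dV hdV hdV0 g hg ιV hιV μA
      μ hμ a χ hρ μW φ Φf hhol hne
    exact ⟨P, Or.inl hP, hfc⟩
  · obtain ⟨P, hP, hfc⟩ := exists_isAntiholCotangentAt_hasFinComponent_of_thetaAntiholCotForm L ι H T hT hdef h2 e₁ dV hdV hdV0 g hg ιV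
      hιV μA μ hμ a χ hρ μW φ Φf hah hne
    exact ⟨P, Or.inr hP, hfc⟩

include hT hdef h2 hg hιV in
set_option synthInstance.maxHeartbeats 400000 in
set_option maxHeartbeats 4000000 in
/-- **B″ with the form a binder** (`Θ` and `hΘ : ∀ x j, Θ x j = Θ̃_{R_e E(φ j ⊗ Φf j)}(charCM χ̃_χ)(ιA x)`): the same conclusion — for consumers whose theta
pair is not syntactically the lambda of `exists_cotangent_hasFinComponent_of_thetaCotForm`.
[cite: Liu2021, Prop. 4.13 proof (Case 1 l. 2131–2137; «Conversely» l. 2145–2149); App. D Lemma D.1] [cite: GelbartRogawski1991, Prop 3.1.1]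
[cite: BorelJacquet1979, §4.6] -/
theorem exists_cotangent_hasFinComponent_of_thetaCotForm'
    (Θ : (adelicGroupData (↥(maximalRealSubfield L)) L (IsCMField.complexConj L) 3 H).Adelic → (Fin 2 → ℂ))
    (hΘ : haveI := normal_range_toAdelic_JW L a
      ∀ (x : (adelicGroupData (↥(maximalRealSubfield L)) L (IsCMField.complexConj L) 3 H).Adelic) (j : Fin 2), Θ x j =
        (lineThetaKernelDatum L 3 e₁ dV hdV hdV0 μ hμ a hρ).thetaLiftFun μW
          (piSBReindex (↥(maximalRealSubfield L)) e₁ (piSchwartzBruhatEquiv (↥(maximalRealSubfield L)) (Fin 3 × Fin 1) (φ j ⊗ₜ[ℂ] Φf j)))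
          (charCM (chiQuot (↥(maximalRealSubfield L)) L (IsCMField.complexConj L) (Algebra.IsQuadraticExtension.finrank_eq_two _ L)
            (IsCMField.complexConj_ne_one (K := L)) a χ))
          ((cmAdelicFrameTransport L 3 H dV g hg) x))
    (htype : Θ ∈ holCotForms (↥(maximalRealSubfield L)) L (IsCMField.complexConj L) 3 H (cmArchSection L ι H T hT) (cmCompactFactor L ι H T hT) ∨
      Θ ∈ (holCotForms (↥(maximalRealSubfield L)) L (IsCMField.complexConj L) 3 H (cmArchSection L ι H T hT) (cmCompactFactor L ι H T hT)).map
          (conjFun (↥(maximalRealSubfield L)) L (IsCMField.complexConj L) 3 H))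
    (hne : Θ ≠ 0) :
    ∃ P : DiscreteAutomorphicRep (adelicGroupData (↥(maximalRealSubfield L)) L (IsCMField.complexConj L) 3 H) μA,
      (P.IsHolCotangentAt (cmArchSection L ι H T hT) (cmCompactFactor L ι H T hT) ∨
          P.IsAntiholCotangentAt (cmArchSection L ι H T hT) (cmCompactFactor L ι H T hT)) ∧
        P.HasFinComponent
          (rhoAtLine (↥(maximalRealSubfield L)) L (IsCMField.complexConj L) 3 e₁ (Matrix.diagonal dV)
            (complexConj_imagUnit L) (imagUnit_ne_zero L) (imagUnit_mul_self L) (realDiagonal_isSymm L dV hdV)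
            (isUnit_det_realDiagonal L dV hdV hdV0) (realDiagonal_map L dV hdV).symm
            (fun b => isCompatible_chiSplittingLine L e₁ dV hdV hdV0 (toHeckeCharacter L μ)
              (isUnitary_toHeckeCharacter L μ) ((isOscillatorChar_toHeckeCharacter_iff μ).mpr hμ)
              (TW (↥(maximalRealSubfield L)) b) (isSymm_TW (↥(maximalRealSubfield L)) b)
              (isUnit_det_TW (↥(maximalRealSubfield L)) b) (JW (↥(maximalRealSubfield L)) L b)
              (JW_eq (↥(maximalRealSubfield L)) L b)) ιV a χ) := by
  haveI := normal_range_toAdelic_JW L a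
  obtain rfl : Θ = fun x j =>
      (lineThetaKernelDatum L 3 e₁ dV hdV hdV0 μ hμ a hρ).thetaLiftFun μW
        (piSBReindex (↥(maximalRealSubfield L)) e₁ (piSchwartzBruhatEquiv (↥(maximalRealSubfield L)) (Fin 3 × Fin 1) (φ j ⊗ₜ[ℂ] Φf j)))
        (charCM (chiQuot (↥(maximalRealSubfield L)) L (IsCMField.complexConj L) (Algebra.IsQuadraticExtension.finrank_eq_two _ L)
          (IsCMField.complexConj_ne_one (K := L)) a χ))
        ((cmAdelicFrameTransport L 3 H dV g hg) x) := funext fun x => funext fun j => hΘ x j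
  exact exists_cotangent_hasFinComponent_of_thetaCotForm L ι H T hT hdef h2 e₁ dV hdV hdV0 g hg ιV hιV μA μ hμ a χ hρ μW φ Φf htype hne

end Summit.HodgeConjecture.HodgeConjecture.Cruxes.H413.F0P2sOccFlatOfThetaForm

end
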